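import Summits.SmoothPoincare4.SmoothPoincare4.Theses.InformationMetricHadamard
import Summits.SmoothPoincare4.SmoothPoincare4.Theorems.InformationMetricHadamardC0AhRecognitionStubNormSubLeEdist
import Mathlib.Analysis.SpecialFunctions.Sqrt

/-!
# Line `core-distance-morse`, crux `InformationMetricHadamard.C0AhRecognition` (stmt-SmoothPoincare4-6015) — stub E1, helper 2: calculus of the distance from a point

In the polar package of helper 1 (`Ex p : ℝ⁵ ≅ W` with `d_G(p, Ex p u) = |u|_{G_p}`, the Gauss
lemma `G(d(Ex p)_u u, d(Ex p)_u w) = G_p(u, w)` and the reversal identity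
`(Ex (Ex p u))⁻¹ p = −d(Ex p)_u u`), the distance from a fixed point `k`,
`d_k = d_G(k, ·) = |(Ex k)⁻¹ ·|_{G_k}`, is differentiable away from `k` along every curve with a
(one-sided) velocity `V`, with derivative `−G((Ex z)⁻¹ k, V)/d_k(z)` at `z` — i.e. the gradient
of `d_k` at `z` is the unit vector `−(Ex z)⁻¹ k / d_k(z)` pointing away from `k` (Lee 2018,
Thm. 6.32 with Cor. 6.12). This is the only differentiation of distances used by the apex stub
(Danskin's one-sided bound for `f = min_k d_k`); `f` itself is never differentiated.

* `helper_gradientLikeField_2` — the statement above, for `HasMFDerivWithinAt` velocities.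

Everything is proved (kind = proof); no definitions.
-/

noncomputable section

-- the prescribed namespace `Summit.<P>.<Sub>.…` duplicates `SmoothPoincare4` (P = Sub)
set_option linter.dupNamespace false

open scoped Manifold ContDiff Topology ENNReal NNReal
open Set Function Bundle

namespace Summit.SmoothPoincare4.SmoothPoincare4.Cruxes.C0AhRecognition.CoreDistanceMorse

open Literature.Geometry.Lorentzian (PseudoRiemannianMetric)
open Literature.Geometry.Lorentzian.PseudoRiemannianMetric

set_option backward.isDefEq.respectTransparency false in
set_option maxHeartbeats 800000 in
/-- **E1 helper 2 (derivative of the distance from a point along a curve).** Let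
`Ex p : ℝ⁵ ≅ W` be polar diffeomorphisms of the Riemannian `(W, G)`:
`d_G(p, Ex p u) = |u|_{G_p}`, Gauss lemma `G(d(Ex p)_u u, d(Ex p)_u w) = G_p(u, w)`, reversal
`(Ex (Ex p u))⁻¹ p = −d(Ex p)_u u`. If `γ` has velocity `V` at `s` within `S` and `γ s ≠ k`, then
`t ↦ d_G(k, γ t)` has derivative `−G((Ex (γ s))⁻¹ k, V) / d_G(k, γ s)` at `s` within `S`
(chain rule through `d_G(k, ·) = |(Ex k)⁻¹ ·|_{G_k}`, then Gauss + reversal to move the formula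
to the point `γ s`). [cite: Lee2018, Thm. 6.32 and Cor. 6.12] -/
theorem helper_gradientLikeField_2 :
    ∀ (W : Type) [TopologicalSpace W] [T2Space W] [SecondCountableTopology W]
    [ChartedSpace (EuclideanSpace ℝ (Fin 5)) W] [IsManifold (𝓡 5) ∞ W]
    (G : Literature.Geometry.Lorentzian.PseudoRiemannianMetric (𝓡 5) ∞ (EuclideanSpace ℝ (Fin 5))
      (TangentSpace (𝓡 5) : W → Type _)) (hG : G.IsRiemannian)
    (Ex : W → (EuclideanSpace ℝ (Fin 5) ≃ₘ^∞⟮𝓡 5, 𝓡 5⟯ W)),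
    (∀ (p : W) (u : EuclideanSpace ℝ (Fin 5)),
      G.edist hG p (Ex p u) = ENNReal.ofReal (Real.sqrt (G.val p u u))) →
    (∀ (p : W) (u w : EuclideanSpace ℝ (Fin 5)),
      G.val (Ex p u) (mfderiv (𝓡 5) (𝓡 5) (Ex p) u u) (mfderiv (𝓡 5) (𝓡 5) (Ex p) u w) =
        G.val p u w) →
    (∀ (p : W) (u : EuclideanSpace ℝ (Fin 5)),
      (Ex (Ex p u)).symm p = -(mfderiv (𝓡 5) (𝓡 5) (Ex p) u u)) →
    ∀ (k : W) (γ : ℝ → W) (S : Set ℝ) (s : ℝ) (V : EuclideanSpace ℝ (Fin 5)),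
      HasMFDerivWithinAt 𝓘(ℝ, ℝ) (𝓡 5) γ S s ((1 : ℝ →L[ℝ] ℝ).smulRight V) → γ s ≠ k →
      HasDerivWithinAt (fun t : ℝ ↦ (G.edist hG k (γ t)).toReal)
        (-(G.val (γ s) ((Ex (γ s)).symm k) V) / (G.edist hG k (γ s)).toReal) S s := by
  intro W _ _ _ _ _ G hG Ex hpol hgauss hrev k γ S s V hγ hne
  -- notation: `Φ = Ex k`, `u t = Φ⁻¹ (γ t)`, `Q v = G_k(v, v)`
  set Φ := Ex k with hΦ
  have hnn : ∀ (x : W) (v : TangentSpace (𝓡 5) x), 0 ≤ G.val x v v := fun x v ↦ by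
    by_cases hv : v = 0
    · subst hv; simp
    · exact (hG x v hv).le
  -- `d_G(k, z) = √(G_k(Φ⁻¹ z, Φ⁻¹ z))`
  have hdist : ∀ z : W, (G.edist hG k z).toReal = Real.sqrt (G.val k (Φ.symm z) (Φ.symm z)) := by
    intro z
    have h := hpol k (Φ.symm z)
    rw [← hΦ, Φ.apply_symm_apply] at h
    rw [h, ENNReal.toReal_ofReal (Real.sqrt_nonneg _)]
  have hfun : (fun t : ℝ ↦ (G.edist hG k (γ t)).toReal) =
      fun t ↦ Real.sqrt (G.val k (Φ.symm (γ t)) (Φ.symm (γ t))) := funext fun t ↦ hdist (γ t)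
  -- the curve `β = Φ⁻¹ ∘ γ` in `ℝ⁵` and its velocity `w₀ = dΦ⁻¹(V)`
  set β : ℝ → EuclideanSpace ℝ (Fin 5) := fun t ↦ Φ.symm (γ t) with hβdef
  set w₀ : EuclideanSpace ℝ (Fin 5) := mfderiv (𝓡 5) (𝓡 5) Φ.symm (γ s) V with hw₀
  have hΦs : HasMFDerivAt (𝓡 5) (𝓡 5) Φ.symm (γ s) (mfderiv (𝓡 5) (𝓡 5) Φ.symm (γ s)) :=
    (Φ.symm.contMDiff.mdifferentiableAt (by simp)).hasMFDerivAt
  have hβm : HasMFDerivWithinAt 𝓘(ℝ, ℝ) (𝓡 5) β S s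
      ((mfderiv (𝓡 5) (𝓡 5) Φ.symm (γ s)).comp ((1 : ℝ →L[ℝ] ℝ).smulRight V)) :=
    hΦs.comp_hasMFDerivWithinAt s hγ
  have hβ : HasDerivWithinAt β w₀ S s := by
    rw [hasDerivWithinAt_iff_hasFDerivWithinAt, ← hasMFDerivWithinAt_iff_hasFDerivWithinAt]
    apply hβm.congr_mfderiv
    rw [ContinuousLinearMap.ext_iff]
    intro a
    rw [ContinuousLinearMap.comp_apply, ContinuousLinearMap.smulRight_apply, map_smul, hw₀]
    rfl
  -- `Q ∘ β` and its derivative `2 G_k(u, w₀)`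
  set u : EuclideanSpace ℝ (Fin 5) := Φ.symm (γ s) with hu
  have hβs : β s = u := rfl
  set B : EuclideanSpace ℝ (Fin 5) →L[ℝ] EuclideanSpace ℝ (Fin 5) →L[ℝ] ℝ := G.val k with hB
  have hBval : ∀ v w : EuclideanSpace ℝ (Fin 5), B v w = G.val k v w := fun _ _ ↦ rfl
  have hc : HasDerivWithinAt (fun t ↦ B (β t)) (B w₀) S s :=
    B.hasFDerivAt.comp_hasDerivWithinAt s hβ
  have hQ : HasDerivWithinAt (fun t ↦ B (β t) (β t)) (B w₀ u + B u w₀) S s := by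
    have h := hc.clm_apply hβ
    rw [hβs] at h
    exact h
  have hQ' : HasDerivWithinAt (fun t ↦ G.val k (Φ.symm (γ t)) (Φ.symm (γ t)))
      (2 * G.val k u w₀) S s := by
    have h2 : B w₀ u + B u w₀ = 2 * G.val k u w₀ := by
      rw [hBval, hBval, G.symm k w₀ u]; ring
    rw [← h2]
    exact hQ
  -- `u ≠ 0` since `γ s ≠ k`
  have hu0 : u ≠ 0 := by
    intro h0
    apply hne
    have : Φ u = γ s := by rw [hu]; exact Φ.apply_symm_apply _
    rw [← this, h0]
    -- `Φ 0 = k`: from the polar distance, `d(k, Φ 0) = 0`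
    have hd : G.edist hG k (Φ 0) = 0 := by
      rw [hΦ, hpol k 0]
      have h00 : G.val k (0 : EuclideanSpace ℝ (Fin 5)) (0 : EuclideanSpace ℝ (Fin 5)) = 0 := by
        rw [← hBval 0 0, map_zero]
      rw [h00, Real.sqrt_zero, ENNReal.ofReal_zero]
    haveI : LocallyCompactSpace W := ChartedSpace.locallyCompactSpace (EuclideanSpace ℝ (Fin 5)) W
    exact ((G.edist_eq_zero_iff hG).1 hd).symm
  have hQpos : G.val k u u ≠ 0 := (hG k u hu0).ne'
  -- the square root
  have hsqrt : HasDerivWithinAt (fun t ↦ Real.sqrt (G.val k (Φ.symm (γ t)) (Φ.symm (γ t))))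
      (2 * G.val k u w₀ / (2 * Real.sqrt (G.val k u u))) S s := hQ'.sqrt hQpos
  have hval : 2 * G.val k u w₀ / (2 * Real.sqrt (G.val k u u)) =
      G.val k u w₀ / Real.sqrt (G.val k u u) := by
    rw [mul_div_mul_left _ _ (two_ne_zero)]
  rw [hval] at hsqrt
  -- move the formula to the point `γ s`: Gauss lemma + reversal
  have hV : mfderiv (𝓡 5) (𝓡 5) Φ u w₀ = V := by
    rw [hu, hw₀]
    exact mfderiv_apply_mfderiv_symm Φ (γ s) V
  have hz : Φ u = γ s := by rw [hu]; exact Φ.apply_symm_apply _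
  have hnum : G.val k u w₀ = -(G.val (γ s) ((Ex (γ s)).symm k) V) := by
    have h1 := hgauss k u w₀
    rw [← hΦ, hV] at h1
    -- `(Ex (Φ u))⁻¹ k = -d(Ex k)_u u`, with the negation read in `T_{Φ u}W`
    have h3 := hrev k u
    rw [← hΦ] at h3
    have h3T : (Ex (Φ u)).symm k =
        (-(mfderiv (𝓡 5) (𝓡 5) Φ u u) : TangentSpace (𝓡 5) (Φ u)) := h3
    have hsw : G.val (Φ u) ((Ex (Φ u)).symm k) V = -(G.val (Φ u) (mfderiv (𝓡 5) (𝓡 5) Φ u u) V) :=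
      calc G.val (Φ u) ((Ex (Φ u)).symm k) V = G.val (Φ u) V ((Ex (Φ u)).symm k) := G.symm _ _ _
        _ = G.val (Φ u) V (-(mfderiv (𝓡 5) (𝓡 5) Φ u u) : TangentSpace (𝓡 5) (Φ u)) := by
            rw [h3T]
        _ = -(G.val (Φ u) V (mfderiv (𝓡 5) (𝓡 5) Φ u u)) := map_neg (G.val (Φ u) V) _
        _ = -(G.val (Φ u) (mfderiv (𝓡 5) (𝓡 5) Φ u u) V) := by rw [G.symm]
    have key : G.val k u w₀ = -(G.val (Φ u) ((Ex (Φ u)).symm k) V) := by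
      rw [hsw, neg_neg, h1]
    rw [hz] at key
    exact key
  have hden : Real.sqrt (G.val k u u) = (G.edist hG k (γ s)).toReal := by
    rw [hdist (γ s)]
  rw [hfun]
  rw [hnum, hden] at hsqrt
  exact hsqrt

end Summit.SmoothPoincare4.SmoothPoincare4.Cruxes.C0AhRecognition.CoreDistanceMorse

end
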